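import Summits.NavierStokesRegularity.NavierStokesRegularity.Theorems.SqueezeCycleNoApexTypeIProfileTypeIBoundIdle
import Literature.Analysis.FluidPDE.TsaiLocalEnergy
import Summits.NavierStokesRegularity.NavierStokesRegularity.Theorems.RellichScarSymmetricScarExistsOneSliceCriterion
import HarnessLib

/-!
# Route SqueezeCycle · item `NoApexTypeIProfile` (stmt-NavierStokesRegularity-11716):
# the kill criterion in the smooth mild world

Helper file (theorems only; no definitions, no named facts), `--supports` the item.

`not_noApexTypeIProfile_iff_mild`: the item FAILS iff some Type-I ancient mild field `V` in the KNSS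
gauge (`IsTypeIAncientMild C V`: jointly smooth on the open slab, divergence free, Oseen integral
equation between all pairs of negative times, rate `C/√(−t)`) with the apex envelope
`‖V(t,x)‖ ≤ C/(‖x‖+√(−t))`, `0 < C`, is unbounded at the space–time origin (exceeds every bound on
every backward cylinder `Q((0,0),r)`).  With `noApexTypeIProfile_iff_knss` (the KNSS-pure form) and the
`𝐈`-free mild representative of `SqueezeCycleNoApexTypeIProfileTypeIBoundIdle.lean`, a refuter may
exhibit a SMOOTH object and never handle weak gradients, `𝐈`, or essential suprema; a prover may
assume smoothness, the Oseen formula and the all-orders scale-invariant package (`stub_apexRegularity`)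
from line one.  Compare the rate-class analogue `RecurrentLiouville/Negative/KillCriterion.lean`.

## References

* G. Koch, N. Nadirashvili, G. Seregin, V. Šverák, Acta Math. 203 (2009) = arXiv:0709.3599, (1.6),
  Lemma 3.1, §4 Prop. 4.1. [KNSS2009]
* D. Albritton, T. Barker, J. Math. Fluid Mech. 21 (2019) = arXiv:1811.00502, §1. [AlbrittonBarker2019]
-/

noncomputable section

-- the sub-problem namespace repeats the summit name (D-0017 layout `Summit.<S>.<P>.Theorems`)
set_option linter.dupNamespace false

namespace Summit.NavierStokesRegularity.NavierStokesRegularity.Theorems.NoApexKNSS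

open Set Filter Function MeasureTheory Metric TopologicalSpace
open scoped Topology ENNReal NNReal
open Literature.Analysis.FluidPDE
open Summit.NavierStokesRegularity.NavierStokesRegularity.Theses
open Summit.NavierStokesRegularity.NavierStokesRegularity.Theorems.ScarRigidity.Negative
  (pos_const_of_apexSingular)
open Summit.NavierStokesRegularity.NavierStokesRegularity.Theorems.SymmetricScarExists.LogtimeBernoulli
  (not_isBackwardSingularPoint_of_bound)

/-- **Kill criterion for `NoApexTypeIProfile` in the smooth mild world.**  The item FAILS iff there is
a Type-I ancient mild field `V` in the KNSS gauge (jointly smooth on the open slab, divergence free,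
Oseen integral equation between all pairs of negative times, rate `C/√(−t)`) with the apex envelope
`‖V(t,x)‖ ≤ C/(‖x‖+√(−t))`, `0 < C`, which is UNBOUNDED at the space–time origin: on every backward
cylinder `Q((0,0), r)` it exceeds every bound.  (`→`: the KNSS-pure form of the item, the `𝐈`-free
mild representative, and `ess sup = ∞` ⇒ no pointwise bound; `←`: `V` is continuous on the open slab,
so pointwise unboundedness at continuity points is essential unboundedness
(`isBackwardSingularPoint_of_forall_exists_continuousAt`), and `V` with its Riesz pressure is a
suitable weak apex profile.)  A refuter of the item may therefore exhibit a SMOOTH object and never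
touch weak gradients, `𝐈`, or essential suprema. [cite: KNSS2009, (1.6) and §4] -/
theorem not_noApexTypeIProfile_iff_mild :
    ¬ SqueezeCycle.NoApexTypeIProfile ↔
      ∃ (C : ℝ) (V : ℝ → (EuclideanSpace ℝ (Fin 3)) → (EuclideanSpace ℝ (Fin 3))),
        0 < C ∧ IsTypeIAncientMild C V ∧ HasTypeIDecay C V ∧
        ∀ r : ℝ, 0 < r → ∀ M : ℝ, ∃ t : ℝ, -r ^ 2 < t ∧ t < 0 ∧
          ∃ x ∈ ball (0 : EuclideanSpace ℝ (Fin 3)) r, M < ‖V t x‖ := by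
  rw [noApexTypeIProfile_iff_knss]
  constructor
  · intro h
    simp only [not_forall, not_not, exists_prop] at h
    obtain ⟨u, p, C, hsw, hd, hsing⟩ := h
    have hC : 0 < C := pos_const_of_apexSingular hd hsing
    obtain ⟨V, hae, hV, hdV⟩ := exists_typeIAncientMild_repr_of_hasTypeIDecay hsw hd
    have hsingV : IsBackwardSingularPoint V 0 :=
      hsing.congr_ae (fun r _ => parabolicCylinder_origin_subset_slab r) hae.symm
    refine ⟨C, V, hC, hV, hdV, fun r hr M => ?_⟩
    by_contra hcon
    push Not at hcon
    exact not_isBackwardSingularPoint_of_bound hr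
      (fun t ht1 ht2 x hx => hcon t ht1 ht2 x hx) hsingV
  · rintro ⟨C, V, hC, hV, hdV, hunb⟩ h
    obtain ⟨Q, hswV, -, -⟩ := exists_pressure_typeIBound_lt_top hC hV hdV
    refine h V Q C hswV hdV (isBackwardSingularPoint_of_forall_exists_continuousAt ?_)
    intro r hr M
    obtain ⟨t, ht1, ht2, x, hx, hM⟩ := hunb r hr M
    have hmem : ((t, x) : ℝ × EuclideanSpace ℝ (Fin 3)) ∈
        parabolicCylinder r (0 : ℝ × EuclideanSpace ℝ (Fin 3)) := by
      rw [mem_parabolicCylinder]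
      exact ⟨⟨by simpa using ht1, by simpa using ht2⟩, by simpa using hx⟩
    have hopen : IsOpen (Iio (0 : ℝ) ×ˢ (univ : Set (EuclideanSpace ℝ (Fin 3)))) :=
      isOpen_Iio.prod isOpen_univ
    have hcont : ContinuousAt (uncurry V) (t, x) :=
      hV.continuousOn_uncurry.continuousAt (hopen.mem_nhds ⟨ht2, mem_univ _⟩)
    exact ⟨(t, x), hmem, hcont, hM⟩

end Summit.NavierStokesRegularity.NavierStokesRegularity.Theorems.NoApexKNSS

end
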